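import Summits.FinalStateConjecture.FinalStateConjecture.Theorems.DrainImpliesDisperse.Negative.DrainImpliesDisperseFalseOfProperPulsedObserver
import Summits.FinalStateConjecture.FinalStateConjecture.Theorems.BondiDrainDispersalDrainImpliesDisperseFramedProper
import HarnessLib

/-!
# Crux `DrainImpliesDisperse` (stmt-FinalStateConjecture-17283), negative side, FRAMED FORM:
# the chart-rigidity clause of the pulsed-observer witness discharged by a global near-Minkowski frame

The negative lemmas of the regularity channel (`Cruxes/DrainImpliesDisperse/REPORT-c3.md`,
REPORT-c4.md) refute the crux as filed on a drained censored development carrying a persistently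
pulsed observer, modulo the construction hypotheses `H = PulsedObserverDevelopmentExists` (p155615;
clause (A): entire asymptotically flat late charts have eventually ACHRONAL slabs) and
`H' = ProperPulsedObserverDevelopmentExists` (p157410; clause (P): such charts are eventually PROPER,
(P) ⇒ (A) by `isAchronal_slab_of_proper_pinched`). Both (A) and (P) quantify over ALL entire late
charts of the development. This file removes that feature: by the framed properness theorem
`FramedProper.isClosed_image_of_frame` (Harris-type rigidity: in a spacetime with a GLOBAL
near-Minkowski frame, pinched future-oriented entire late charts have closed half-space images),
clause (P) follows from

* (G) a global near-Minkowski frame of the development: mutually inverse smooth `Θ : E4 → M`,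
  `Ξ : M → E4` with `Θ` `C⁰`-pinched, `‖(Θ^* g − η)(x)‖ < 1/4`, and future-oriented (`Θ_* ∂₀`
  future-directed), whose frame time is bounded below on the future of the data,
  `(Ξ a)⁰ ≥ 0` for `a ∈ J⁺(ι X)`,

a single structural property of the development, of the kind every global stability theorem
delivers (a global coordinate system in which `g − η` is uniformly small in `C⁰`, the data
hypersurface at frame time `0`). The resulting construction hypothesis
`H'' = FramedPulsedObserverDevelopmentExists` — a drained censored MGHD of an admissible datum with
(G) and a persistently pulsed, ray-borne, all-seeing future timelike observer — implies `H'` field by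
field (`properPulsedObserverDevelopmentExists_of_framed`) and hence refutes the crux
(`DrainImpliesDisperse_false_of_framedPulsedObserverDevelopmentExists`). For the maximal development
of the far-field ripple datum `δ + ε r⁻¹⁰ sin(r⁴) w₀` of REPORT-c3 every clause of `H''` is a
standard expectation of small-data theory in every norm but weighted `C³` (global `C⁰`/`C¹`
closeness to Minkowski in a global gauge; causal geodesic completeness; non-decaying focused tidal
pulses on the central worldline); it is not constructible in the tree (no maximal development of a
non-flat admissible datum). Line lead `prover-line-stmt-FinalStateConjecture-17283-c5-0`, 2026-08-17.
-/

noncomputable section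

set_option linter.dupNamespace false -- D-0017: `Summit.<S>.<S>.…` by design

open Set Filter Function TopologicalSpace Topology
open scoped Manifold ContDiff Topology

namespace Summit.FinalStateConjecture.FinalStateConjecture.Theorems.DrainImpliesDisperse.Negative

open Literature.Geometry.Lorentzian
open Summit.FinalStateConjecture (HasCompleteNullInfinity)
open Summit.FinalStateConjecture.FinalStateConjecture.Theses.BondiDrainDispersal (DrainImpliesDisperse)

/-- **Clause (P) from a global near-Minkowski frame.** In a spacetime with a global near-Minkowski
frame `(Θ, Ξ)` (mutually inverse, `Θ` pinched `< 1/4` and future-oriented) whose frame time is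
`≥ 0` on a set `O`, every late chart `Φ` of the flat background over `U ⊇ {x⁰ > τ₀}` into `O` whose
`C²` deviation on entire slabs tends to `0` and whose `Φ_* ∂₀` is eventually future-directed on slabs
has eventually closed half-space images `Φ({x⁰ ≥ τ₁})` (`C²`-decay gives `C⁰`-pinching beyond a
late chart time; then `FramedProper.isClosed_image_of_frame`). Harris, CQG 5 (1988) 111 (framed
form). [cite: ONeillSemiRiemannian1983, Ch. 5, Lemma 5.26] -/
theorem eventually_isClosed_image_of_frame (𝓢 : Spacetime 4)
    (Θ : Minkowski.background.domain → 𝓢.carrier) (Ξ : 𝓢.carrier → E4)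
    (hΘ : ContMDiff 𝓘(ℝ, E4) (𝓡 4) ∞ Θ) (hΞ : ContMDiff (𝓡 4) 𝓘(ℝ, E4) ∞ Ξ)
    (hΘΞ : ∀ p, Θ ⟨Ξ p, Opens.mem_top _⟩ = p)
    (hpinΘ : ∀ x, ‖𝓢.deviation Minkowski.background Θ x‖ < 1 / 4)
    (hfutΘ : ∀ x, 𝓢.timeOrientation.IsFutureDirected
      (mfderiv 𝓘(ℝ, E4) (𝓡 4) Θ x (E4.basisVector 0)))
    (O : Set 𝓢.carrier) (hO : ∀ a ∈ O, 0 ≤ E4.time (Ξ a))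
    (U : Opens E4) (τ₀ : ℝ) (Φ : (Minkowski.backgroundOn U).domain → 𝓢.carrier)
    (hU : Minkowski.lateRegion τ₀ ⊆ (U : Set E4))
    (hlate : 𝓢.IsLateChart (Minkowski.backgroundOn U) O τ₀ Φ)
    (hdec : Tendsto (fun τ ↦ 𝓢.deviationCk (Minkowski.backgroundOn U) Φ 2 τ) atTop (𝓝 0))
    (hfut : ∀ᶠ τ in atTop, ∀ x ∈ (Minkowski.backgroundOn U).timeSlab τ,
      𝓢.timeOrientation.IsFutureDirected (mfderiv 𝓘(ℝ, E4) (𝓡 4) Φ x (E4.basisVector 0))) :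
    ∀ᶠ τ₁ in atTop,
      IsClosed (Φ '' {x : (Minkowski.backgroundOn U).domain | τ₁ ≤ (x : E4) 0}) := by
  -- eventually the `C²` deviation on entire slabs is `< 1/4`
  have hquarter : (0 : ENNReal) < ENNReal.ofReal (1 / 4) := ENNReal.ofReal_pos.2 (by norm_num)
  have hpinch : ∀ᶠ τ in atTop,
      𝓢.deviationCk (Minkowski.backgroundOn U) Φ 2 τ < ENNReal.ofReal (1 / 4) :=
    (tendsto_order.1 hdec).2 _ hquarter
  obtain ⟨T₁, hT₁⟩ := eventually_atTop.1 (hpinch.and hfut)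
  obtain ⟨τ₁, hτ₁T, h01⟩ : ∃ τ₁ : ℝ, T₁ ≤ τ₁ ∧ τ₀ < τ₁ :=
    ⟨max T₁ (τ₀ + 1), le_max_left _ _, (lt_add_one _).trans_le (le_max_right _ _)⟩
  -- `C⁰`-pinching beyond `τ₁`
  have hpin : ∀ x : (Minkowski.backgroundOn U).domain, τ₁ < (x : E4) 0 →
      ‖𝓢.deviation (Minkowski.backgroundOn U) Φ x‖ < 1 / 4 := by
    intro x hx
    have h1 := (hT₁ _ (hτ₁T.trans hx.le)).1
    have hxslab : (x : E4) ∈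
        Subtype.val '' (Minkowski.backgroundOn U).timeSlab ((x : E4) 0) := ⟨x, rfl, rfl⟩
    have h2 : ‖iteratedFDeriv ℝ 0 (𝓢.deviationExtend (Minkowski.backgroundOn U) Φ) (x : E4)‖ₑ ≤
        𝓢.deviationCk (Minkowski.backgroundOn U) Φ 2 ((x : E4) 0) :=
      enorm_iteratedFDeriv_le_supCkENorm (Nat.zero_le 2) hxslab _
    have h3 : ‖iteratedFDeriv ℝ 0 (𝓢.deviationExtend (Minkowski.backgroundOn U) Φ) (x : E4)‖ =
        ‖𝓢.deviation (Minkowski.backgroundOn U) Φ x‖ := by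
      rw [norm_iteratedFDeriv_zero, Spacetime.deviationExtend_coe]
    have h4 : ENNReal.ofReal ‖𝓢.deviation (Minkowski.backgroundOn U) Φ x‖ <
        ENNReal.ofReal (1 / 4) := by
      rw [← h3, ofReal_norm]
      exact h2.trans_lt h1
    exact (ENNReal.ofReal_lt_ofReal_iff (by norm_num)).1 h4
  -- orientation beyond `τ₁`
  have hfut' : ∀ x : (Minkowski.backgroundOn U).domain, τ₁ < (x : E4) 0 →
      𝓢.timeOrientation.IsFutureDirected (mfderiv 𝓘(ℝ, E4) (𝓡 4) Φ x (E4.basisVector 0)) :=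
    fun x hx ↦ (hT₁ _ (hτ₁T.trans hx.le)).2 x rfl
  -- floor: the late image lies in `O`
  have hfloor : ∀ x : (Minkowski.backgroundOn U).domain, τ₁ < (x : E4) 0 →
      0 ≤ E4.time (Ξ (Φ x)) := fun x hx ↦
    hO _ (hlate.image_subset (mem_image_of_mem Φ (show τ₀ < (x : E4) 0 from h01.trans hx)))
  have hcl := FramedProper.isClosed_image_of_frame 𝓢 Θ Ξ hΘ hΞ hΘΞ hpinΘ hfutΘ U Φ τ₀ τ₁ h01.le
    hU hlate.contMDiff hpin hfut' 0 hfloor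
  filter_upwards [eventually_gt_atTop τ₁] with τ₂ hτ₂
  exact hcl τ₂ hτ₂

/-- **Construction hypothesis `H''` (framed form of `ProperPulsedObserverDevelopmentExists`): a
drained censored development with a GLOBAL NEAR-MINKOWSKI FRAME and a persistently pulsed
observer.** Some admissible datum has a maximal vacuum Cauchy development `𝒟` with complete future
null infinity (sojourn form) and vanishing final Bondi mass, together with: (G) a global
near-Minkowski frame — smooth `Θ : E4 → M`, `Ξ : M → E4` with `Θ (Ξ p) = p`, `Θ` `C⁰`-pinched
(`‖(Θ^* g − η)(x)‖ < 1/4` for all `x`) and future-oriented (`Θ_* ∂₀` future-directed), with frame time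
`(Ξ a)⁰ ≥ 0` on `J⁺(ι X)`; and a curve `c : ℝ → M` and a floor `0 < δ` with (T) `c` future timelike on
`[0, ∞)`, (R) every `c s`, `s ≥ 0`, on a future-complete normalised null ray from the data at a
parameter `≥ 0`, (V) `∀ a ∈ J⁺(ι X), ∃ s ≥ 0, a ≪ c s`, (W) for every `s₀` a later `s > s₀` at which no
local chart of the flat background through `c s` is `δ`-quiet in `C²`. Expected on paper for the
maximal development of the far-field ripple datum `δ + ε r⁻¹⁰ sin(r⁴) w₀`
(`Cruxes/DrainImpliesDisperse/REPORT-c3.md`, REPORT-c5.md): (G) is global `C⁰` closeness to Minkowski in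
a global gauge with the data slice at frame time `0` (small data in every norm but weighted `C³`), the
rest as for `H`. NOT constructible in the tree today (no maximal development of any non-flat admissible
datum). Construction hypothesis of a negative lemma, not a published fact (no citation tag). -/
def FramedPulsedObserverDevelopmentExists : Prop :=
  ∃ (X : Type) (_ : TopologicalSpace X) (_ : ChartedSpace E3 X) (_ : IsManifold (𝓡 3) ∞ X)
    (_ : T2Space X) (_ : SecondCountableTopology X) (_ : ConnectedSpace X)
    (D : InitialDataSet (𝓡 3) X) (_ : D ∈ admissibleVacuumData X) (𝒟 : VacuumCauchyDevelopment D)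
    (_ : 𝒟.IsMaximal) (_ : HasCompleteNullInfinity 𝒟.toCauchyDevelopment)
    (_ : 𝒟.toCauchyDevelopment.HasVanishingFinalBondiMass)
    (Θ : Minkowski.background.domain → 𝒟.carrier) (Ξ : 𝒟.carrier → E4)
    (c : ℝ → 𝒟.carrier) (δ : ENNReal),
    ContMDiff 𝓘(ℝ, E4) (𝓡 4) ∞ Θ ∧ ContMDiff (𝓡 4) 𝓘(ℝ, E4) ∞ Ξ ∧
    (∀ p, Θ ⟨Ξ p, Opens.mem_top _⟩ = p) ∧
    (∀ x, ‖𝒟.toSpacetime.deviation Minkowski.background Θ x‖ < 1 / 4) ∧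
    (∀ x, 𝒟.timeOrientation.IsFutureDirected (mfderiv 𝓘(ℝ, E4) (𝓡 4) Θ x (E4.basisVector 0))) ∧
    (∀ a ∈ 𝒟.metric.causalFuture 𝒟.timeOrientation (range 𝒟.embed), 0 ≤ E4.time (Ξ a)) ∧
    0 < δ ∧
    𝒟.metric.IsFutureTimelikeCurveOn 𝒟.timeOrientation c (Ici 0) ∧
    (∀ [𝒟.metric.HasLeviCivita], ∀ s : ℝ, 0 ≤ s →
      ∃ (p : X) (γ : ℝ → 𝒟.carrier) (dom : Set ℝ) (t : ℝ),
        𝒟.metric.IsNormalisedNullRayFrom 𝒟.timeOrientation 𝒟.embed 𝒟.normal p γ dom ∧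
          ¬ BddAbove dom ∧ t ∈ dom ∧ 0 ≤ t ∧ γ t = c s) ∧
    (∀ a ∈ 𝒟.metric.causalFuture 𝒟.timeOrientation (range 𝒟.embed),
      ∃ s : ℝ, 0 ≤ s ∧ c s ∈ 𝒟.metric.chronologicalFuture 𝒟.timeOrientation {a}) ∧
    (∀ s₀ : ℝ, ∃ s : ℝ, s₀ < s ∧
      ∀ (U : Opens E4) (Φ : (Minkowski.backgroundOn U).domain → 𝒟.carrier)
        (V : Set (Minkowski.backgroundOn U).domain) (x : (Minkowski.backgroundOn U).domain),
        IsOpen V → x ∈ V → ContMDiff 𝓘(ℝ, E4) (𝓡 4) ∞ Φ → IsOpenEmbedding (V.restrict Φ) →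
        Φ x = c s →
        δ ≤ supCkENorm {(x : E4)} 2 (𝒟.toSpacetime.deviationExtend (Minkowski.backgroundOn U) Φ))

/-- **`H''` implies `H'`**: a global near-Minkowski frame with frame time `≥ 0` on `J⁺(ι X)` yields
clause (P) of `ProperPulsedObserverDevelopmentExists` for every late chart into `J⁺(ι X)`
(`eventually_isClosed_image_of_frame`); the other fields are carried over. [folklore] -/
theorem properPulsedObserverDevelopmentExists_of_framed (H : FramedPulsedObserverDevelopmentExists) :
    ProperPulsedObserverDevelopmentExists := by
  obtain ⟨X, _, _, _, _, _, _, D, hD, 𝒟, hmax, hcni, hdrain, Θ, Ξ, c, δ, hΘ, hΞ, hΘΞ, hpinΘ, hfutΘ,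
    hfloor, hδ, hc, hray, hvis, hwild⟩ := H
  refine ⟨X, inferInstance, inferInstance, inferInstance, inferInstance, inferInstance, inferInstance, D,
    hD, 𝒟, hmax, hcni, hdrain, c, δ, hδ, hc, hray, hvis, hwild, ?_⟩
  intro U τ₀ Φ hU hlate hdec hfut
  exact eventually_isClosed_image_of_frame 𝒟.toSpacetime Θ Ξ hΘ hΞ hΘΞ hpinΘ hfutΘ _ hfloor U τ₀ Φ
    hU hlate hdec hfut

/-- **Negative lemma modulo `FramedPulsedObserverDevelopmentExists`** (framed form): one drained
censored maximal development of one admissible datum with a global near-Minkowski frame and a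
persistently pulsed, ray-borne, all-seeing future timelike observer falsifies `DrainImpliesDisperse`
as filed. [folklore] -/
theorem DrainImpliesDisperse_false_of_framedPulsedObserverDevelopmentExists
    (H : FramedPulsedObserverDevelopmentExists) : ¬ DrainImpliesDisperse :=
  DrainImpliesDisperse_false_of_properPulsedObserverDevelopmentExists
    (properPulsedObserverDevelopmentExists_of_framed H)

end Summit.FinalStateConjecture.FinalStateConjecture.Theorems.DrainImpliesDisperse.Negative

end
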